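import Literature.IUT.HodgeTheaters.GoodLocalFrobenioidOfKit
import Literature.IUT.HodgeTheaters.ReconstructibleAlongCriterion
import HarnessLib

/-!
# [IUTchI] Example 3.3 (iii) (a)(b)(c) at the first REAL instance `GoodLocalFrobenioid.ofKitQp p`

Mochizuki, *Inter-universal Teichmüller theory I*, §3, Example 3.3 (iii) (a)–(c), kurims May-2020 manuscript
p. 79 [claim: Mochizuki2012, status: disputed]: "(a) the subcategory `D⊢_v ⊆ D_v` may be reconstructed
category-theoretically from `D_v` [cf. [AbsAnab], Lemma 1.3.8]; (b) the category `D⊢_v` (respectively, `D^Θ_v`)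
may be reconstructed category-theoretically from `C⊢_v` (respectively, `C^Θ_v`); (c) the category `D_v` may be
reconstructed category-theoretically from `F̲_v = C_v`". abc-iut cell, WAVE-4 seat abc-iut-w4-d047; DAG node
`IUTchI:Ex3.3(iii)`; kernel probe of the audit of p413332 (abc-iut-L5-t2, `GoodLocalFrobenioidOfKit.lean`).

abc-iut-L5-t2's `GoodLocalFrobenioid.ofKitQp p` is the interface `GoodLocalFrobenioid p ℚ_p` assembled from
abc-iut-L1-t4's REAL [FrdII] Example 1.1 Frobenioids `C(ℚ_p) ⊇ C⊢(ℚ_p)` over the one-object base (trivial `π₁`: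
`D_v = D⊢_v = Spec ℚ_p`). The typed clauses (a) `DdashFromD`, (b) `BasesFromC`, (c) `DFromF` are SCHEMAS
(admissible only at named instances: FACT-LIST v3 rows F-0039 ff., `BadLocalFrobenioidClaimsIndependence*.lean`);
THIS FILE discharges them AT THIS NAMED INSTANCE — (a) through the criterion
`reconstructibleAlong_of_essSurj` (the inclusion is the identity), (b)(c) because the bases are the terminal
category. The Frobenioid-side clauses (d) `CdashFromF`, (e) `SplitFromF` concern self-equivalences of the REAL
`p`-adic Frobenioid `C(ℚ_p)` ([FrdI] Thm. 3.4 / [FrdII] Thm. 1.2 category-theoreticity) and are NOT touched here.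
Honest scope: a degenerate base (one object); nothing of the series is asserted; typed ≠ proved elsewhere.
-/

namespace Literature.IUT.HodgeTheaters

open CategoryTheory

namespace GoodLocalFrobenioid

variable (p : ℕ) [Fact p.Prime]

/-- Any two functors into the one-object discrete category are isomorphic. [folklore] -/
private theorem nonempty_iso_of_target_punit {C : Type} [Category.{0} C] (F G : C ⥤ Discrete PUnit.{1}) :
    Nonempty (F ≅ G) :=
  ⟨NatIso.ofComponents (fun _ => eqToIso (Subsingleton.elim _ _)) (fun _ => Subsingleton.elim _ _)⟩

/-- **Ex. 3.3 (iii) (a) at `ofKitQp p`**: `D⊢_v ⊆ D_v` is reconstructible from `D_v` — here the inclusion is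
the identity of `Spec ℚ_p`, an equivalence, so the criterion `reconstructibleAlong_of_essSurj` applies.
[claim: Mochizuki2012, status: disputed] -/
theorem ddashFromD_ofKitQp : (ofKitQp p).DdashFromD := by
  change ReconstructibleAlong (𝟭 (Discrete PUnit.{1}))
  exact reconstructibleAlong_of_essSurj _

/-- **Ex. 3.3 (iii) (b) at `ofKitQp p`**: the bases `D⊢_v`, `D^Θ_v` (the one-object category) are
reconstructible from `C⊢_v`, `C^Θ_v`: every self-equivalence of the REAL Frobenioid `C⊢(ℚ_p)` descends
(trivially) to the point. [claim: Mochizuki2012, status: disputed] -/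
theorem basesFromC_ofKitQp : (ofKitQp p).BasesFromC :=
  ⟨fun _ => ⟨CategoryTheory.Equivalence.refl, nonempty_iso_of_target_punit _ _⟩,
    fun _ => ⟨CategoryTheory.Equivalence.refl, nonempty_iso_of_target_punit _ _⟩⟩

/-- **Ex. 3.3 (iii) (c) at `ofKitQp p`**: the base `D_v` (the one-object category) is reconstructible from
`F̲_v = C_v`: every self-equivalence of the REAL Frobenioid `C(ℚ_p)` descends (trivially) to the point.
[claim: Mochizuki2012, status: disputed] -/
theorem dFromF_ofKitQp : (ofKitQp p).DFromF :=
  fun _ => ⟨CategoryTheory.Equivalence.refl, nonempty_iso_of_target_punit _ _⟩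

/-- The three base-side clauses of Ex. 3.3 (iii) hold simultaneously at the named REAL instance `ofKitQp p`.
[claim: Mochizuki2012, status: disputed] -/
theorem ex33iii_base_ofKitQp : (ofKitQp p).DdashFromD ∧ (ofKitQp p).BasesFromC ∧ (ofKitQp p).DFromF :=
  ⟨ddashFromD_ofKitQp p, basesFromC_ofKitQp p, dFromF_ofKitQp p⟩

end GoodLocalFrobenioid

end Literature.IUT.HodgeTheaters
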